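import Summits.QuantumFields.QCD.Theorems.QuarksAsStableActionStableActionBridgeTorusDenominator
import Summits.QuantumFields.QCD.Theorems.QuarksAsStableActionStableActionBridgeTorusDenominatorAP
import Summits.QuantumFields.QCD.Theorems.QuarksAsStableActionStableActionBridgeTransferPositivity
import Summits.QuantumFields.QCD.Theorems.QuarksAsStableActionStableActionBridgeTransferLevelBounds
import Summits.QuantumFields.QCD.Theorems.QuarksAsStableActionStableActionBridgeStubCyclicPeelC
import Summits.QuantumFields.QCD.Theorems.QuarksAsStableActionStableActionBridgeStubSpectralTraceC
import Summits.QuantumFields.QCD.Theorems.QuarksAsStableActionStableActionBridgeStubFermionSliceOpSqrt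
import Summits.QuantumFields.QCD.Theorems.QuarksAsStableActionStableActionBridgeStubScalarKernelProps
import Summits.QuantumFields.QCD.Theorems.QuarksAsStableActionStableActionBridgeStubCyclicScalarise
import Summits.QuantumFields.QCD.Theorems.QuarksAsStableActionStableActionBridgeStubJointEigenbasisInvolution
import Summits.QuantumFields.QCD.Theorems.QuarksAsStableActionStableActionBridgeStubMulInvolutionOp
import Summits.QuantumFields.QCD.Theorems.QuarksAsStableActionStableActionBridgeStubExistsTopIndex
import Summits.QuantumFields.QCD.Theorems.QuarksAsStableActionStableActionBridgeStubLevelZeroEqEigenmax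
import Literature.Analysis.OperatorTheory.HermitianKernelOperator
import Literature.Analysis.OperatorTheory.IntegralOperatorHilbertSchmidt
import Literature.Analysis.OperatorTheory.JointEigenbasis
import Mathlib.MeasureTheory.Measure.SeparableMeasure
import HarnessLib

/-!
# Spectral representation of both torus denominators of lattice QCD
(stub `stub_torusDenominators_spectral` of line `twisted_trace_transfer`, crux `QuarksAsStableAction.StableActionBridge`,
stmt-QuantumFields-9737; the deliverable of step E3 of the crux's F3 roadmap — lead assembly, cycle 18)

For `β ≥ 0`, all bare Wilson masses `m_f > −1` and every four-torus `(ℤ/N)⁴`, `N ≥ 2`, the Wilson-measure averages of the two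
fermionic Berezin partition functions of `N_f`-flavour lattice QCD — time-PERIODIC quarks (`fermiBoltzmann`, the STATEMENT's
functional `qcdTorusExpect`) and THERMAL quarks (`fermiBoltzmannAP`, antiperiodic across one temporal layer) — are, up to the common
positive factor `ε · Z_W` (`ε` the Berezin orientation sign, `Z_W` the pure-gauge partition function),

  `Σᵢ σᵢ λᵢ^N`  (supertrace)   and   `Σᵢ λᵢ^N`  (trace)

over ONE countable family of levels `0 ≤ λᵢ ≤ λ_{i₀} = qcdTransferLevel N_f N β m 0`, `0 < λ_{i₀}`, `Σ λᵢ² < ∞`, with parities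
`σᵢ = ±1`: the eigenvalues, with fermion parities, of Lüscher's transfer operator realised as the compact self-adjoint integral operator
on `L²(SU(3)^{E₃} × Finset(modes), Haar ⊗ count; ℂ)` with kernel `k((U,s),(U',s')) = (R(U) B(U,U') R(U'))_{s s'}`
(`R = √T̂_F`, `B(U,U') = ∫ K_β(U,U'^g) Γ(G_g) dg`).

Assembly of the landed sub-goals of the line: `stub_fermionSliceOp_sqrt` (`R`), `stub_scalarKernel_props` (`k` bounded, measurable,
Hermitian, parity selection rule), `Literature.Analysis.OperatorTheory.exists_hermitianKernelOp` (the operator `A`),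
`stub_mulInvolutionOp` (parity `F` on `L²`), `stub_jointEigenbasis_involution` (parity-adapted eigenbasis), separability of `L²`
(countable index), `stub_levelZero_eq_eigenmax` + `stub_exists_top_index` (levels in `[0, level 0]`, top level attained),
`stub_spectralTraceC` (trace formulas with insertion, and `Σ λᵢ² < ∞`), `stub_cyclicPeelC` (cyclic integral = diagonal iterate),
`stub_cyclic_scalarise` and the capstones `Sketch.integral_fermiBoltzmann(AP)_wilsonMeasure_eq_cyclic_(super)trace`.
References: Lüscher 1977; Montvay–Münster (4.34); Reed–Simon I Thm VI.16, VI.22–23.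
-/

noncomputable section

namespace Summit.QuantumFields.QCD.Cruxes.StableActionBridge.TwistedTraceTransfer

open MeasureTheory Filter
open scoped InnerProductSpace ComplexConjugate Matrix BigOperators ENNReal
open Literature.MathematicalPhysics.QuantumFieldTheory Literature.MathematicalPhysics.QuantumLattice
open Literature.Probability.LatticeModels (TorusSite)
open Literature.Analysis.OperatorTheory

namespace StubTorusDenominatorsSpectral

/-- The pure-gauge Boltzmann integral `Z_W = ∫ e^{−β S_W} ∏ dU` over product Haar measure is strictly positive. -/
theorem wilsonBoltzmann_integral_pos (N : ℕ) [NeZero N] (β : ℝ) :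
    0 < ∫ U : GaugeConfig 4 N (Matrix.specialUnitaryGroup (Fin 3) ℂ), Real.exp (-(β * wilsonAction (fundamentalRep (Fin 3)) U))
      ∂(Measure.pi fun _ : Edge 4 N => haarProbability (Matrix.specialUnitaryGroup (Fin 3) ℂ)) := by
  have hc : Continuous fun U : GaugeConfig 4 N (Matrix.specialUnitaryGroup (Fin 3) ℂ) => Real.exp (-(β * wilsonAction (fundamentalRep (Fin 3)) U)) :=
    Real.continuous_exp.comp
      ((Literature.MathematicalPhysics.QuantumFieldTheory.continuous_wilsonAction _
        (continuous_fundamentalRep (Fin 3))).const_mul β).neg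
  have hi : Integrable (fun U : GaugeConfig 4 N (Matrix.specialUnitaryGroup (Fin 3) ℂ) => Real.exp (-(β * wilsonAction (fundamentalRep (Fin 3)) U)))
      (Measure.pi fun _ : Edge 4 N => haarProbability (Matrix.specialUnitaryGroup (Fin 3) ℂ)) :=
    hc.integrable_of_hasCompactSupport (HasCompactSupport.of_compactSpace _)
  rw [integral_pos_iff_support_of_nonneg (fun U => (Real.exp_pos _).le) hi]
  have hsupp : Function.support (fun U : GaugeConfig 4 N (Matrix.specialUnitaryGroup (Fin 3) ℂ) =>
      Real.exp (-(β * wilsonAction (fundamentalRep (Fin 3)) U))) = Set.univ :=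
    Set.eq_univ_of_forall fun U => (Real.exp_pos _).ne'
  rw [hsupp, measure_univ]
  exact zero_lt_one

/-- `ε · Z_W · (ε · I / Z_W) = I` for the Berezin sign `ε = (−1)^n` and `Z_W ≠ 0`. -/
theorem sign_cancel (n : ℕ) {Z : ℝ} (hZ : Z ≠ 0) (I : ℂ) :
    (-1 : ℂ) ^ n * (Z : ℂ) * ((-1 : ℂ) ^ n * I / (Z : ℂ)) = I := by
  have hZ' : (Z : ℂ) ≠ 0 := Complex.ofReal_ne_zero.2 hZ
  have h1 : ((-1 : ℂ) ^ n) * ((-1 : ℂ) ^ n) = 1 := by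
    rw [← pow_add, ← two_mul, pow_mul]; norm_num
  field_simp
  linear_combination I * h1

/-- `∫ ‖φ‖² dρ = 1` for a unit vector of `L²` (cast to `ℂ`). -/
theorem integral_norm_sq_eq_one {Y : Type} [MeasurableSpace Y] {ρ : Measure Y} (φ : Lp ℂ 2 ρ) (hφ : ‖φ‖ = 1) :
    ∫ y, ((‖(φ : Y → ℂ) y‖ ^ 2 : ℝ) : ℂ) ∂ρ = 1 := by
  have h := norm_toLp_sq_eq_integral_norm_sq (𝕜 := ℂ) (Lp.memLp φ)
  rw [Lp.toLp_coeFn, hφ, one_pow] at h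
  rw [integral_complex_ofReal, ← h]; simp

end StubTorusDenominatorsSpectral

open StubTorusDenominatorsSpectral in
/-- **Spectral representation of BOTH torus denominators of lattice QCD** (stub `stub_torusDenominators_spectral`; E3).  For `β ≥ 0`,
all `m_f > −1` and every torus `(ℤ/N)⁴`, `N ≥ 2`, there are a countable family of levels `λᵢ ≥ 0` with parities `σᵢ = ±1` and a top
index `i₀` with `0 ≤ λᵢ ≤ λ_{i₀} = qcdTransferLevel N_f N β m 0`, `0 < λ_{i₀}`, `Σ λᵢ² < ∞`, such that
`ε · Z_W · ∫ ∫dψ̄dψ e^{−ψ̄ D^{AP} ψ} dμ_W = Σᵢ λᵢ^N` (thermal denominator = `Tr 𝕋^N`) and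
`ε · Z_W · ∫ ∫dψ̄dψ e^{−ψ̄ D ψ} dμ_W = Σᵢ σᵢ λᵢ^N` (the statement's periodic denominator = `STr 𝕋^N`).
[cite: Luscher1977, pp. 283–292] [cite: MontvayMunster1994, §4.1 (4.34)] [cite: ReedSimonI1980, Thm. VI.16 and VI.22–23] -/
theorem stub_torusDenominators_spectral : ∀ (Nf N : ℕ) [NeZero N], 2 ≤ N → ∀ (β : ℝ) (mq : Fin Nf → ℝ),
    0 ≤ β → (∀ f, -1 < mq f) →
    ∃ (ι : Type) (_ : Countable ι) (lam σ : ι → ℝ) (i₀ : ι),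
      (∀ i, 0 ≤ lam i ∧ lam i ≤ lam i₀) ∧ (∀ i, σ i = 1 ∨ σ i = -1) ∧ 0 < lam i₀ ∧
      lam i₀ = qcdTransferLevel Nf N β mq 0 ∧ Summable (fun i => lam i ^ 2) ∧
      HasSum (fun i => (lam i : ℂ) ^ N)
        ((-1 : ℂ) ^ (Fintype.card (FermiIdx Nf N) * (Fintype.card (FermiIdx Nf N) - 1) / 2 + Fintype.card (FermiIdx Nf N)) *
          ((∫ U : GaugeConfig 4 N (Matrix.specialUnitaryGroup (Fin 3) ℂ), Real.exp (-(β * wilsonAction (fundamentalRep (Fin 3)) U))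
              ∂(Measure.pi fun _ : Edge 4 N => haarProbability (Matrix.specialUnitaryGroup (Fin 3) ℂ)) : ℝ) : ℂ) *
          ∫ U : GaugeConfig 4 N (Matrix.specialUnitaryGroup (Fin 3) ℂ), fermiIntegral (fermiBoltzmannAP U mq)
            ∂(wilsonMeasure (d := 4) (L := N) (fundamentalRep (Fin 3)) β)) ∧
      HasSum (fun i => (σ i : ℂ) * (lam i : ℂ) ^ N)
        ((-1 : ℂ) ^ (Fintype.card (FermiIdx Nf N) * (Fintype.card (FermiIdx Nf N) - 1) / 2 + Fintype.card (FermiIdx Nf N)) *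
          ((∫ U : GaugeConfig 4 N (Matrix.specialUnitaryGroup (Fin 3) ℂ), Real.exp (-(β * wilsonAction (fundamentalRep (Fin 3)) U))
              ∂(Measure.pi fun _ : Edge 4 N => haarProbability (Matrix.specialUnitaryGroup (Fin 3) ℂ)) : ℝ) : ℂ) *
          ∫ U : GaugeConfig 4 N (Matrix.specialUnitaryGroup (Fin 3) ℂ), fermiIntegral (fermiBoltzmann U mq)
            ∂(wilsonMeasure (d := 4) (L := N) (fundamentalRep (Fin 3)) β)) := by
  intro Nf N _ hN β mq hβ hm
  -- the spaces
  set X := GaugeConfig 3 N (Matrix.specialUnitaryGroup (Fin 3) ℂ) with hXdef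
  set Fι := Finset (SliceFermiIdx Nf N) with hFdef
  set ρ : Measure (X × Fι) := (sliceHaar N).prod (Measure.count : Measure Fι) with hρ
  haveI : SecondCountableTopology (Matrix (Fin 3) (Fin 3) ℂ) := inferInstance
  haveI : SecondCountableTopology (Matrix.specialUnitaryGroup (Fin 3) ℂ) := Topology.IsEmbedding.subtypeVal.secondCountableTopology
  haveI hprob : IsProbabilityMeasure (sliceHaar (S := N)) := Sketch.isProbabilityMeasure_sliceHaar N
  haveI : IsFiniteMeasure ρ := by rw [hρ]; infer_instance
  haveI : MeasureTheory.IsSeparable ρ := by rw [hρ]; infer_instance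
  haveI : Fact ((2 : ℝ≥0∞) ≠ ⊤) := ⟨ENNReal.ofNat_ne_top⟩
  -- B1: the square root
  obtain ⟨R, hRc, hR⟩ := stub_fermionSliceOp_sqrt Nf N mq hm
  have hR2 : ∀ U, (R U)ᴴ = R U ∧ R U * R U = fermionSliceOp U mq := fun U => ⟨(hR U).1, (hR U).2.1⟩
  -- the scalar kernel and its properties (C6)
  set k : X × Fι → X × Fι → ℂ := fun y y' => (R y.1 * (Matrix.of fun a c => ∫ g : TorusSite 3 N → (Matrix.specialUnitaryGroup (Fin 3) ℂ),
      (gaugeSliceKernel β y.1 (gaugeTransform g y'.1) : ℂ) * @fockGaugeAct Nf N _ g a c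
        ∂(Measure.pi fun _ => haarProbability (Matrix.specialUnitaryGroup (Fin 3) ℂ))) * R y'.1) y.2 y'.2 with hk
  obtain ⟨-, hkm, ⟨C, hkC⟩, hkh, hkpar⟩ := stub_scalarKernel_props Nf N β mq hm R hRc hR k (fun _ _ => rfl)
  -- the operator
  obtain ⟨A, hA, hsa, hcpt, -⟩ := exists_hermitianKernelOp ρ k C hkm hkC hkh
  -- parity
  set w : X × Fι → ℝ := fun y => (-1 : ℝ) ^ y.2.card with hw
  have hwm : Measurable w := by
    refine Measurable.comp (g := fun s : Fι => (-1 : ℝ) ^ s.card) (measurable_of_countable _) measurable_snd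
  have hw1 : ∀ y, w y = 1 ∨ w y = -1 := fun y => by
    rcases neg_one_pow_eq_or ℝ y.2.card with h | h <;> simp [hw, h]
  have hwc : ∀ y, ((w y : ℝ) : ℂ) = (-1 : ℂ) ^ y.2.card := fun y => by simp [hw]
  obtain ⟨F, hF, hFsa, hFF, hFcomm, hFinner⟩ := stub_mulInvolutionOp (X × Fι) ρ w hwm hw1
  have hinter : ∀ x y, k x y * (w y : ℂ) = (w x : ℂ) * k x y := by
    intro x y
    by_cases hxy : (-1 : ℂ) ^ x.2.card = (-1 : ℂ) ^ y.2.card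
    · rw [hwc, hwc, hxy, mul_comm]
    · rw [hkpar x y hxy, zero_mul, mul_zero]
  have hAF : A * F = F * A := hFcomm k C hkm hkC hinter A hA
  -- parity-adapted eigenbasis (C5)
  obtain ⟨ι, b, lam, σ, hb, hFb, hσ⟩ :=
    stub_jointEigenbasis_involution (Lp ℂ 2 ρ) A F hsa hcpt hFsa hFF hAF
  -- countability of the index
  have hinj : Function.Injective (b : ι → Lp ℂ 2 ρ) := b.orthonormal.linearIndependent.injective
  haveI hcnt : Countable ι := by
    have hon : Orthonormal ℂ ((↑) : Set.range (b : ι → Lp ℂ 2 ρ) → Lp ℂ 2 ρ) :=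
      (orthonormal_subtype_range hinj).2 b.orthonormal
    haveI := (hon.countable_of_separableSpace (𝕜 := ℂ)).to_subtype
    have hinj' : Function.Injective (fun i : ι => (⟨b i, i, rfl⟩ : Set.range (b : ι → Lp ℂ 2 ρ))) :=
      fun i j h => hinj (congrArg Subtype.val h)
    exact hinj'.countable
  -- levels in [0, level 0], leastness (D3)
  obtain ⟨hbound, hleast⟩ := stub_levelZero_eq_eigenmax Nf N β mq hβ hm R hRc hR2 k (fun _ _ => rfl) A hsa hA ι b lam hb
  -- Σ λ² < ∞ from the trace formula with F = 1, M = 0 (A2)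
  have hone : ∀ i, ∫ y, ((‖(b i : X × Fι → ℂ) y‖ ^ 2 : ℝ) : ℂ) ∂ρ = 1 :=
    fun i => integral_norm_sq_eq_one (b i) (b.orthonormal.norm_eq_one i)
  have hS2 : Summable fun i => lam i ^ 2 := by
    have h := stub_spectralTraceC (X × Fι) ρ k C hkm hkC hkh A hA ι b lam hb (fun _ => (1 : ℂ)) 1 measurable_const
      (fun _ => by simp) 0
    have hfun : (fun i => (lam i : ℂ) ^ (0 + 2) * ∫ x, (1 : ℂ) * ((‖(b i : X × Fι → ℂ) x‖ ^ 2 : ℝ) : ℂ) ∂ρ) =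
        fun i => ((lam i ^ 2 : ℝ) : ℂ) := by
      funext i
      have h1 : ∫ x, (1 : ℂ) * ((‖(b i : X × Fι → ℂ) x‖ ^ 2 : ℝ) : ℂ) ∂ρ = 1 := by
        simp only [one_mul]; exact hone i
      rw [h1, mul_one, Complex.ofReal_pow]
    rw [hfun] at h
    exact Complex.summable_ofReal.1 h.summable
  -- top index (D2)
  set s := qcdTransferLevel Nf N β mq 0 with hs
  have hs0 : 0 < s := Sketch.TransferLevelBounds.qcdTransferLevel_zero_pos hβ hm
  obtain ⟨i₀, hi₀⟩ := stub_exists_top_index ι lam s hs0 hS2 (fun i => (hbound i).2) hleast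
  -- the cyclic integrals: N = M + 2
  obtain ⟨M, rfl⟩ : ∃ M, N = M + 2 := ⟨N - 2, by omega⟩
  have hP : ∀ U, Matrix.diagonal (fun s : Fι => (-1 : ℂ) ^ s.card) * R U =
      R U * Matrix.diagonal (fun s : Fι => (-1 : ℂ) ^ s.card) :=
    fun U => (hR U).2.2 _ (StubScalarKernelProps.parity_comm_fermionSliceOp U mq)
  obtain ⟨hAP, hPer⟩ := stub_cyclic_scalarise Nf (M + 2) β mq R hRc (fun U => (hR U).2.1) hP
  -- the cyclic integrals over `Y` are diagonal iterates (A1)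
  set κ : (X × Fι → ℂ) → X × Fι → ℂ := fun f x => ∫ z, k x z * f z ∂ρ with hκ
  have hkmeas : Measurable (Function.uncurry k) := hkm.measurable
  have hwb : ∀ y, ‖((w y : ℝ) : ℂ)‖ ≤ 1 := fun y => by
    rcases hw1 y with h | h <;> simp [h]
  have hwmC : Measurable fun y : X × Fι => ((w y : ℝ) : ℂ) := Complex.measurable_ofReal.comp hwm
  have hiter : ∀ (G : X × Fι → ℂ) (x : X × Fι),
      (κ^[0 + 1]) (fun y => (1 : ℂ) * (κ^[M]) (fun z => k z x) y) x = (κ^[M + 1]) (fun z => k z x) x := by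
    intro G x
    have e : (fun y => (1 : ℂ) * (κ^[M]) (fun z => k z x) y) = (κ^[M]) (fun z => k z x) := funext fun y => one_mul _
    rw [e, zero_add, Function.iterate_one, ← Function.iterate_succ_apply' κ M]
  have hpeel1 : ∫ V : Fin (M + 2) → X × Fι, ∏ t, k (V t) (V (t + 1)) ∂(Measure.pi fun _ => ρ) =
      ∫ x, (κ^[M + 1]) (fun z => k z x) x ∂ρ := by
    have h := stub_cyclicPeelC (X × Fι) ρ k C hkmeas hkC M 0 (fun _ => (1 : ℂ)) (fun _ => (1 : ℂ)) 1 1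
      measurable_const measurable_const (fun _ => by simp) (fun _ => by simp) ⟨1, by omega⟩ rfl
    have h' : ∫ V : Fin (M + 2) → X × Fι, (1 : ℂ) * 1 * ∏ t, k (V t) (V (t + 1)) ∂(Measure.pi fun _ => ρ) =
        ∫ x, (1 : ℂ) * (κ^[0 + 1]) (fun y => (1 : ℂ) * (κ^[M]) (fun z => k z x) y) x ∂ρ := h
    have hl : (fun V : Fin (M + 2) → X × Fι => (1 : ℂ) * 1 * ∏ t, k (V t) (V (t + 1))) =
        fun V => ∏ t, k (V t) (V (t + 1)) := funext fun V => by rw [one_mul, one_mul]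
    rw [hl] at h'
    refine h'.trans (integral_congr_ae (Eventually.of_forall fun x => ?_))
    dsimp only
    rw [one_mul, hiter (fun _ => 1) x]
  have hpeelw : ∫ V : Fin (M + 2) → X × Fι, (-1 : ℂ) ^ (V 0).2.card * ∏ t, k (V t) (V (t + 1))
        ∂(Measure.pi fun _ => ρ) = ∫ x, ((w x : ℝ) : ℂ) * (κ^[M + 1]) (fun z => k z x) x ∂ρ := by
    have h := stub_cyclicPeelC (X × Fι) ρ k C hkmeas hkC M 0 (fun y => ((w y : ℝ) : ℂ)) (fun _ => (1 : ℂ)) 1 1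
      hwmC measurable_const hwb (fun _ => by simp) ⟨1, by omega⟩ rfl
    have h' : ∫ V : Fin (M + 2) → X × Fι, ((w (V 0) : ℝ) : ℂ) * 1 * ∏ t, k (V t) (V (t + 1))
          ∂(Measure.pi fun _ => ρ) =
        ∫ x, ((w x : ℝ) : ℂ) * (κ^[0 + 1]) (fun y => (1 : ℂ) * (κ^[M]) (fun z => k z x) y) x ∂ρ := h
    have hl : (fun V : Fin (M + 2) → X × Fι => ((w (V 0) : ℝ) : ℂ) * 1 * ∏ t, k (V t) (V (t + 1))) =
        fun V => (-1 : ℂ) ^ (V 0).2.card * ∏ t, k (V t) (V (t + 1)) := funext fun V => by rw [mul_one, hwc]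
    rw [hl] at h'
    refine h'.trans (integral_congr_ae (Eventually.of_forall fun x => ?_))
    dsimp only
    rw [hiter (fun _ => 1) x]
  -- trace formulas (A2)
  have htr1 := stub_spectralTraceC (X × Fι) ρ k C hkm hkC hkh A hA ι b lam hb (fun _ => (1 : ℂ)) 1 measurable_const
    (fun _ => by simp) M
  have htrw := stub_spectralTraceC (X × Fι) ρ k C hkm hkC hkh A hA ι b lam hb (fun y => ((w y : ℝ) : ℂ)) 1 hwmC hwb M
  simp only [one_mul] at htr1
  -- positivity of Z_W and the capstones
  have hZ := wilsonBoltzmann_integral_pos (M + 2) β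
  have hcapAP := Sketch.integral_fermiBoltzmannAP_wilsonMeasure_eq_cyclic_trace Nf (M + 2) β mq hm
  have hcapP := Sketch.integral_fermiBoltzmann_wilsonMeasure_eq_cyclic_supertrace Nf (M + 2) β mq hm
  -- assemble
  refine ⟨ι, hcnt, lam, σ, i₀, fun i => ⟨(hbound i).1, hi₀ ▸ (hbound i).2⟩, hσ, hi₀ ▸ hs0, hi₀, hS2, ?_, ?_⟩
  · -- thermal: trace
    rw [hcapAP, sign_cancel _ hZ.ne', hAP]
    have hval : ∫ V : Fin (M + 2) → X × Fι, ∏ t, k (V t) (V (t + 1)) ∂(Measure.pi fun _ => ρ) =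
        ∫ x, (κ^[M + 1]) (fun z => k z x) x ∂ρ := hpeel1
    have hterm : (fun i => (lam i : ℂ) ^ (M + 2)) =
        fun i => (lam i : ℂ) ^ (M + 2) * ∫ x, ((‖(b i : X × Fι → ℂ) x‖ ^ 2 : ℝ) : ℂ) ∂ρ :=
      funext fun i => by rw [hone i, mul_one]
    rw [hterm]
    convert htr1 using 1
  · -- periodic: supertrace
    rw [hcapP, sign_cancel _ hZ.ne', hPer]
    have hterm : (fun i => (σ i : ℂ) * (lam i : ℂ) ^ (M + 2)) =
        fun i => (lam i : ℂ) ^ (M + 2) * ∫ x, ((w x : ℝ) : ℂ) * ((‖(b i : X × Fι → ℂ) x‖ ^ 2 : ℝ) : ℂ) ∂ρ := by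
      funext i
      rw [← hFinner (b i), hFb i, inner_smul_right, inner_self_eq_norm_sq_to_K, b.orthonormal.norm_eq_one i]
      push_cast
      ring
    rw [hterm]
    convert htrw using 1

end Summit.QuantumFields.QCD.Cruxes.StableActionBridge.TwistedTraceTransfer

end
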